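import Mathlib
import HarnessLib
import Literature.Analysis.ODE.LiouvilleInvariantMeasure
import Summits.Ventures.LatticeQCDFlow.Exactness.SphereLuscherTrivialization

/-!
# Lüscher's theorem as an equality of measures on the lattice of site spheres: under the flow equation the push-forward of `π̄` by the evolution map IS the tilted measure, `(Φ_{0→c})_*π̄ = e^{−cS}π̄/Z_c`

HONEST FRAMING: exact (Metropolis-corrected) sampling algorithms for lattice gauge theory;
figures of merit are autocorrelation/cost numbers at stated couplings and volumes; no
continuum-physics claim.

Venture `LatticeQCDFlow` (cell pub-lqcd), topic `Exactness`; FANOUT row 7 (`s0-cpn-null`).  NEW WORK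
of the cell over the tree's `Exactness/SphereLuscherTrivialization.lean` and
`Exactness/SphereFlowTransportCovariance.lean` (this leg: Lüscher's theorem in weak form — equal
integrals of every `C¹` ambient test functional — for the time-dependent and the autonomous sphere
flows), `Exactness/SphereGradientFlow.lean` (GEN-13: `sphereFlowMap`) and the tree's PROVED
`Literature/Analysis/ODE/LiouvilleInvariantMeasure.lean`
(`measure_ext_of_forall_integral_contDiff_eq`: finite measures on a finite-dimensional space with
equal mass and equal integrals of `C¹` compactly supported functions coincide — Stone–Weierstrass
through Mathlib's `ext_of_forall_mem_subalgebra_integral_eq_of_polish`) and Mathlib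
(`Continuous.isClosedEmbedding`, `MeasurableEmbedding.map_injective`, `isProbabilityMeasure_tilted`);
nothing is cited as a fact.  Printed counterpart, NAMED ONLY: M. Lüscher, Commun. Math. Phys. 293
(2010) 899, §3 (3.4)–(3.9): the trivializing map transports the a-priori measure to `e^{−S}`.

* §1 **MEASURES ON `Ω = S(E)^Λ` ARE DETERMINED BY THE `C¹` AMBIENT TEST FUNCTIONALS**
  (**`measure_sphereConfig_ext_of_forall_integral_contDiff_eq`**): two probability measures on
  `Λ → S(E)` with `∫H(ω)dμ = ∫H(ω)dν` for every `C¹` functional `H` on `Λ → E` are equal (push both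
  forward along the closed embedding `ω ↦ (ω_n)_n ∈ Λ → E`, compare there, pull back by injectivity
  of the push-forward along a measurable embedding).
* §2 **LÜSCHER'S THEOREM, MEASURE FORM** (**`map_sphereTDFlow_eq_tilted`**): if the jointly `C²`
  generator `G_s` solves `𝓛_sG_s = S + C_s` on `Ω` for `s ∈ [0, c]`, the push-forward of `π̄` along
  the time-`0`-to-time-`c` evolution map of Lüscher's flow, read in the ambient space, equals the
  tilted probability measure `π̄.tilted(−cS) = e^{−cS}π̄/Z_c` read in the ambient space; and for an
  autonomous generator with GEN-13's flow map on sphere configurations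
  (**`map_sphereFlowMap_eq_tilted`**): `(sphereFlowMap hG c)_*π̄ = π̄.tilted(−cS)` AS MEASURES ON `Ω`.

NOT CLAIMED: existence of exact solutions of the flow equation; the Jacobian of the map; anything
quantitative.
-/

noncomputable section

namespace Summit.Ventures.LatticeQCDFlow.Exactness

open Function Set Metric MeasureTheory NormedSpace InnerProductSpace Topology
open scoped RealInnerProductSpace

variable {Λ : Type*} {E : Type*} [NormedAddCommGroup E] [InnerProductSpace ℝ E]
  [FiniteDimensional ℝ E] [Fintype Λ] [DecidableEq Λ] [MeasurableSpace E] [BorelSpace E]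

/-! ## §1 Measures on the product of spheres are determined by the `C¹` ambient functionals -/

section Ext

omit [DecidableEq Λ] [Fintype Λ] [MeasurableSpace E] [BorelSpace E] in
/-- The coercion `ω ↦ (ω_n)_n : (Λ → S(E)) → (Λ → E)` is a closed embedding (continuous and
injective on a compact space). -/
theorem isClosedEmbedding_sphereConfig :
    IsClosedEmbedding fun ω : Λ → sphere (0 : E) 1 => fun n => (ω n : E) :=
  continuous_sphereConfig.isClosedEmbedding fun _ _ h => funext fun n =>
    Subtype.ext (congrFun h n)

omit [DecidableEq Λ] in
/-- … hence a measurable embedding. -/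
theorem measurableEmbedding_sphereConfig :
    MeasurableEmbedding fun ω : Λ → sphere (0 : E) 1 => fun n => (ω n : E) :=
  isClosedEmbedding_sphereConfig.measurableEmbedding

omit [DecidableEq Λ] in
/-- **Probability measures on `Ω = S(E)^Λ` are determined by the integrals of the `C¹` functionals
of the ambient space `Λ → E`.** -/
theorem measure_sphereConfig_ext_of_forall_integral_contDiff_eq
    {μ ν : Measure (Λ → sphere (0 : E) 1)} [IsProbabilityMeasure μ] [IsProbabilityMeasure ν]
    (h : ∀ H : (Λ → E) → ℝ, ContDiff ℝ 1 H →
      ∫ ω, H (fun n => ((ω : Λ → sphere (0 : E) 1) n : E)) ∂μ = ∫ ω, H (fun n => (ω n : E)) ∂ν) :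
    μ = ν := by
  have hmeas : Measurable fun ω : Λ → sphere (0 : E) 1 => fun n => (ω n : E) :=
    continuous_sphereConfig.measurable
  refine measurableEmbedding_sphereConfig.map_injective ?_
  haveI : IsProbabilityMeasure (Measure.map (fun ω : Λ → sphere (0 : E) 1 => fun n => (ω n : E)) μ) :=
    Measure.isProbabilityMeasure_map hmeas.aemeasurable
  haveI : IsProbabilityMeasure (Measure.map (fun ω : Λ → sphere (0 : E) 1 => fun n => (ω n : E)) ν) :=
    Measure.isProbabilityMeasure_map hmeas.aemeasurable
  refine Literature.Analysis.ODE.measure_ext_of_forall_integral_contDiff_eq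
    (by rw [measure_univ, measure_univ]) fun ψ hψ _ => ?_
  rw [integral_map hmeas.aemeasurable hψ.continuous.aestronglyMeasurable,
    integral_map hmeas.aemeasurable hψ.continuous.aestronglyMeasurable]
  exact h ψ hψ

end Ext

/-! ## §2 Lüscher's theorem as an equality of measures -/

section Luscher

variable [Nontrivial E]

omit [DecidableEq Λ] in
/-- The tilted measure `π̄.tilted(−cS) = e^{−cS}π̄/Z_c` is a probability measure (`S` continuous). -/
theorem isProbabilityMeasure_tilted_neg_action {S : (Λ → E) → ℝ} (hS : Continuous S) (c : ℝ) :
    IsProbabilityMeasure ((Measure.pi (fun _ : Λ => uniformSphere (volume : Measure E))).tilted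
      (fun ω : Λ → sphere (0 : E) 1 => -(c * S (fun m => (ω m : E))))) :=
  isProbabilityMeasure_tilted (integrable_pi_of_continuous _ (continuous_exp_neg_mul_sphereConfig hS c))

variable {G : ℝ → (Λ → E) → ℝ}

/-- **LÜSCHER'S THEOREM, MEASURE FORM (time-dependent generator).**  If the jointly `C²` generator
solves `𝓛_sG_s = S + C_s` on `Ω` for every `s ∈ [0, c]` (`S ∈ C¹`, `c ≥ 0`), then the law of
`Φ_{0→c}(ω)` under `π̄`, read in the ambient space `Λ → E`, IS the tilted probability measure
`e^{−cS}π̄/Z_c` read in the ambient space: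
`map (ω ↦ Φ_{0→c}ω) π̄ = map (ω ↦ ω) (π̄.tilted(−cS))`. -/
theorem map_sphereTDFlow_eq_tilted {S : (Λ → E) → ℝ} (hS : ContDiff ℝ 1 S)
    (hG : ContDiff ℝ 2 fun q : ℝ × (Λ → E) => G q.1 q.2) {c : ℝ} (hc : 0 ≤ c) {C : ℝ → ℝ}
    (hsol : ∀ s ∈ Icc 0 c, ∀ ω : Λ → sphere (0 : E) 1,
      sphereLuscherL S s (G s) (fun m => (ω m : E)) = S (fun m => (ω m : E)) + C s) :
    Measure.map (fun ω : Λ → sphere (0 : E) 1 => sphereTDFlow hG c 0 c (fun m => (ω m : E)))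
        (Measure.pi (fun _ : Λ => uniformSphere (volume : Measure E))) =
      Measure.map (fun ω : Λ → sphere (0 : E) 1 => fun m => (ω m : E))
        ((Measure.pi (fun _ : Λ => uniformSphere (volume : Measure E))).tilted
          (fun ω => -(c * S (fun m => (ω m : E))))) := by
  have hΦc : Continuous fun ω : Λ → sphere (0 : E) 1 => sphereTDFlow hG c 0 c (fun m => (ω m : E)) :=
    (contDiff_sphereTDFlow_apply hG 0 c).continuous.comp continuous_sphereConfig
  have hmeas : Measurable fun ω : Λ → sphere (0 : E) 1 => fun n => (ω n : E) :=
    continuous_sphereConfig.measurable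
  haveI := isProbabilityMeasure_tilted_neg_action (Λ := Λ) hS.continuous c
  haveI : IsProbabilityMeasure (Measure.map
      (fun ω : Λ → sphere (0 : E) 1 => sphereTDFlow hG c 0 c (fun m => (ω m : E)))
      (Measure.pi (fun _ : Λ => uniformSphere (volume : Measure E)))) :=
    Measure.isProbabilityMeasure_map hΦc.measurable.aemeasurable
  haveI : IsProbabilityMeasure (Measure.map (fun ω : Λ → sphere (0 : E) 1 => fun m => (ω m : E))
      ((Measure.pi (fun _ : Λ => uniformSphere (volume : Measure E))).tilted
        (fun ω => -(c * S (fun m => (ω m : E)))))) :=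
    Measure.isProbabilityMeasure_map hmeas.aemeasurable
  refine Literature.Analysis.ODE.measure_ext_of_forall_integral_contDiff_eq
    (by rw [measure_univ, measure_univ]) fun ψ hψ _ => ?_
  rw [integral_map hΦc.measurable.aemeasurable hψ.continuous.aestronglyMeasurable,
    integral_map hmeas.aemeasurable hψ.continuous.aestronglyMeasurable]
  exact luscher_trivialization_tilted hS hG hψ hc hsol

variable {G₀ : (Λ → E) → ℝ}

/-- **LÜSCHER'S CRITERION, MEASURE FORM (autonomous generator): `(Φ_c)_*π̄ = e^{−cS}π̄/Z_c` AS
MEASURES ON `Ω`.**  If `G ∈ C²` solves `𝓛_sG = S + C_s` on `Ω` for every `s ∈ [0, c]` (`S ∈ C¹`,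
`c ≥ 0`), the push-forward of the a-priori product measure along GEN-13's flow map
`sphereFlowMap hG c : (Λ → S(E)) → (Λ → S(E))` equals the tilted probability measure. -/
theorem map_sphereFlowMap_eq_tilted {S : (Λ → E) → ℝ} (hS : ContDiff ℝ 1 S) (hG : ContDiff ℝ 2 G₀)
    {c : ℝ} (hc : 0 ≤ c) {C : ℝ → ℝ}
    (hsol : ∀ s ∈ Icc 0 c, ∀ ω : Λ → sphere (0 : E) 1,
      sphereLuscherL S s G₀ (fun m => (ω m : E)) = S (fun m => (ω m : E)) + C s) :
    Measure.map (sphereFlowMap hG c) (Measure.pi (fun _ : Λ => uniformSphere (volume : Measure E))) =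
      (Measure.pi (fun _ : Λ => uniformSphere (volume : Measure E))).tilted
        (fun ω : Λ → sphere (0 : E) 1 => -(c * S (fun m => (ω m : E)))) := by
  haveI := isProbabilityMeasure_tilted_neg_action (Λ := Λ) hS.continuous c
  haveI : IsProbabilityMeasure (Measure.map (sphereFlowMap hG c)
      (Measure.pi (fun _ : Λ => uniformSphere (volume : Measure E)))) :=
    Measure.isProbabilityMeasure_map (measurable_sphereFlowMap hG c).aemeasurable
  refine measure_sphereConfig_ext_of_forall_integral_contDiff_eq fun H hH => ?_
  have hcH : Continuous fun ω : Λ → sphere (0 : E) 1 => H (fun n => (ω n : E)) :=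
    hH.continuous.comp continuous_sphereConfig
  rw [integral_map (measurable_sphereFlowMap hG c).aemeasurable hcH.aestronglyMeasurable]
  simp only [coe_sphereFlowMap]
  exact integral_comp_sphereGradientFlow_eq_integral_tilted hS hG hH hc hsol

end Luscher

end Summit.Ventures.LatticeQCDFlow.Exactness

end
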